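import Mathlib
import Literature.NumberTheory.LFunctions.Zhang2022.SkeletonPartOneB
import Literature.NumberTheory.LFunctions.Zhang2022.SkeletonAssembly
import Literature.NumberTheory.LFunctions.Zhang2022.Section5Lemma59
import HarnessLib

/-!
# Zhang (2022) §5, Lemma 5.9 — preliminaries for the deduction "Proposition 2.2 ⇒ Lemma 5.9":
# finiteness and spacing of the zeros of `L(s,ψ)L(s,ψχ)` in `Ω`, the Jensen disc inside `Ω`,
# and the bookkeeping of the zero-sum terms at the manuscript's scales

Topic `Literature/NumberTheory/LFunctions/Zhang2022` (Landau–Siegel audit tree; verdict-neutral;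
D-0069 campaign node **Z22:Lem5.9.pf**, locator [Z22 p.29–30, §5 Lemma 5.9 and (5.16),
tex L1630–L1664]). Y. Zhang, *Discrete mean estimates and the Landau–Siegel zero*,
arXiv:2211.02515v1 (2022) [Zhang2022LandauSiegel] — **an unrefereed manuscript under adjudication**.

This file collects the devices used by `Section5Lemma59Ded.lean` (the kernel-checked deduction
`Skeleton.Prop22 c′ → Lemma 5.9 on |t − 2πt₀| ≤ 𝓛₁ + 1/4`) — theorems only, no definition, no
named fact: finiteness of the zero set of `L(s,ψ)L(s,ψχ)` in `Ω` (`prodZeroSetOmega_finite`,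
identity principle, `ψχ` primitive by `Skeleton.psiChiPrimitive_holds`); Proposition 2.2 (iii) ⇒
pairwise separation (`gap_of_consecutive`, `discZeros_separated`); the Jensen disc
`|ρ − (2+it)| ≤ 81/50` of `DirichletLogDerivDisc` lies in `Ω` for `|t − 2πt₀| ≤ 𝓛₁ + 1/4`
(`mem_prodZeroSetOmega_of_mem_discZeros`); Proposition 2.2 (ii) ⇒ disc weights `1`
(`discDivisor_eq_one_of_deriv_ne_zero`); and the elementary bookkeeping (`ell_disc_le`:
`log p + log(|t|+4) ≤ 3𝓛⁹`; `bookkeeping_le`: the zero-sum terms `≤ B_κ + log(1/α)`; `mem_disc`).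
WHAT THIS IS NOT: any statement about Theorems 1–2 of the manuscript or about Landau–Siegel zeros.

## References

* Y. Zhang, arXiv:2211.02515v1 (2022), §5 Lemma 5.9, (5.16); §2 (2.7), (2.10), (2.13),
  Proposition 2.2. [cite: Zhang2022LandauSiegel, §5 Lemma 5.9]
* H. L. Montgomery, R. C. Vaughan, *Multiplicative Number Theory I*, CUP 2007, Lemma 12.1
  (through the tree's `DirichletLogDerivDisc.lean`). [cite: MontgomeryVaughan2007, Lemma 12.1]
-/

noncomputable section

open Complex Real Set Metric Filter _root_.Topology Finset

namespace Literature.NumberTheory.LFunctions.Zhang2022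

namespace Lemma59Ded

open Skeleton Literature.NumberTheory.LFunctions.DirichletDisc

/-! ### Finiteness of the zeros of `L(s,ψ)L(s,ψχ)` in `Ω` and the pairwise gap from Prop. 2.2 (iii) -/

/-- For `D ≥ 3` and `χ` primitive, the zero set of `L(s,ψ)L(s,ψχ)` in `Ω` (the set Proposition 2.2
is about) is finite: the product is entire (`ψ`, `ψχ` primitive, non-principal) and `≠ 0` at
`s = 2`, and `Ω` is bounded (identity principle). [cite: Zhang2022LandauSiegel, §2 Prop. 2.2] -/
theorem prodZeroSetOmega_finite {D : ℕ} [NeZero D] (χ : DirichletCharacter ℂ D) (x : Chr D)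
    (hD : 3 ≤ D) (hχ : χ.IsPrimitive) : (prodZeroSetOmega χ x).Finite := by
  by_contra hinf
  have hprim : (psiChi χ x).IsPrimitive := psiChiPrimitive_holds D χ x hD hχ
  have hne1 : psiChi χ x ≠ 1 := by
    refine GammaFactor.ne_one_of_isPrimitive hprim ?_
    have : 1 < D * x.p := lt_of_lt_of_le (by omega) (Nat.le_mul_of_pos_right D x.prime.pos)
    omega
  set f : ℂ → ℂ := fun w => x.ψ.LFunction w * (psiChi χ x).LFunction w with hf
  set c : ℂ := s0 D with hc
  have hsub : prodZeroSetOmega χ x ⊆ Metric.closedBall c (1 / 2 + (ell1 D + 2)) := by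
    intro ρ hρ
    obtain ⟨⟨hre, him⟩, -⟩ := hρ
    rw [Metric.mem_closedBall, dist_eq_norm]
    have h := Complex.norm_le_abs_re_add_abs_im (ρ - c)
    linarith [le_of_lt hre, le_of_lt him]
  obtain ⟨z₀, -, hacc⟩ :=
    Set.Infinite.exists_accPt_of_subset_isCompact hinf (isCompact_closedBall c _) hsub
  have hfreq : ∃ᶠ z in nhdsWithin z₀ {z₀}ᶜ, f z = 0 :=
    (accPt_iff_frequently_nhdsNE.mp hacc).mono fun z hz => hz.2
  have hdiff : Differentiable ℂ f :=
    (DirichletCharacter.differentiable_LFunction x.ψ_ne_one).mul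
      (DirichletCharacter.differentiable_LFunction hne1)
  have hanal : AnalyticOnNhd ℂ f Set.univ :=
    Complex.analyticOnNhd_univ_iff_differentiable.mpr hdiff
  have hzero := hanal.eqOn_zero_of_preconnected_of_frequently_eq_zero isPreconnected_univ
    (Set.mem_univ z₀) hfreq
  have h2 : f 2 ≠ 0 := by
    simp only [hf]
    exact mul_ne_zero
      (DirichletCharacter.LFunction_ne_zero_of_one_le_re x.ψ (Or.inl x.ψ_ne_one) (by norm_num))
      (DirichletCharacter.LFunction_ne_zero_of_one_le_re _ (Or.inl hne1) (by norm_num))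
  exact h2 (hzero (Set.mem_univ (2 : ℂ)))

/-- **From consecutive gaps to pairwise gaps.** If the zeros of `L(s,ψ)L(s,ψχ)` in `Ω` form a finite
set and consecutive ones (in ordinate) satisfy `|γ′ − γ − α| < c′α²𝓛` (Proposition 2.2 (iii) at
`ψ`), then ANY two of them with `γ < γ′` satisfy `γ′ − γ > α − c′α²𝓛` (take the first zero above
`γ`). [cite: Zhang2022LandauSiegel, §2 Prop. 2.2 (iii)] -/
theorem gap_of_consecutive {D : ℕ} [NeZero D] {χ : DirichletCharacter ℂ D} {x : Chr D} {c' : ℝ}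
    (hfin : (prodZeroSetOmega χ x).Finite)
    (hiii : ∀ s ∈ prodZeroSetOmega χ x, ∀ s' ∈ prodZeroSetOmega χ x, s.im < s'.im →
      (∀ s'' ∈ prodZeroSetOmega χ x, ¬ (s.im < s''.im ∧ s''.im < s'.im)) →
        |s'.im - s.im - alpha D| < c' * alpha D ^ 2 * ell D)
    {ρ ρ' : ℂ} (hρ : ρ ∈ prodZeroSetOmega χ x) (hρ' : ρ' ∈ prodZeroSetOmega χ x)
    (hlt : ρ.im < ρ'.im) : alpha D - c' * alpha D ^ 2 * ell D < ρ'.im - ρ.im := by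
  classical
  -- the zeros strictly above `ρ` and not above `ρ'`, as a finite set; it contains `ρ'`
  set S : Finset ℂ := hfin.toFinset.filter (fun u => ρ.im < u.im ∧ u.im ≤ ρ'.im) with hS
  have hρ'S : ρ' ∈ S := by
    rw [hS, Finset.mem_filter, Set.Finite.mem_toFinset]
    exact ⟨hρ', hlt, le_rfl⟩
  obtain ⟨u₀, hu₀S, hu₀min⟩ := S.exists_min_image (fun u => u.im) ⟨ρ', hρ'S⟩
  rw [hS, Finset.mem_filter, Set.Finite.mem_toFinset] at hu₀S
  obtain ⟨hu₀Z, hu₀lt, hu₀le⟩ := hu₀S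
  -- `ρ` and `u₀` are consecutive
  have hcons : ∀ s'' ∈ prodZeroSetOmega χ x, ¬ (ρ.im < s''.im ∧ s''.im < u₀.im) := by
    rintro s'' hs'' ⟨h1, h2⟩
    have hs''S : s'' ∈ S := by
      rw [hS, Finset.mem_filter, Set.Finite.mem_toFinset]
      exact ⟨hs'', h1, le_trans h2.le hu₀le⟩
    have := hu₀min s'' hs''S
    linarith
  have h := hiii ρ hρ u₀ hu₀Z hu₀lt hcons
  rw [abs_lt] at h
  linarith [h.1]

/-! ### The Jensen disc at heights `|t − 2πt₀| ≤ 𝓛₁ + 1/4` sits inside `Ω` -/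

/-- A zero of `L(s,ψ)` in the disc `|ρ − (2+it)| ≤ 81/50` with `|t − 2πt₀| ≤ 𝓛₁ + 1/4` is a zero of
`L(s,ψ)L(s,ψχ)` in `Ω` (`19/50 ≤ Re ρ < 1`, `|Im ρ − 2πt₀| ≤ 81/50 + 𝓛₁ + 1/4 < 𝓛₁ + 2`).
[cite: Zhang2022LandauSiegel, §2 (2.7)] -/
theorem mem_prodZeroSetOmega_of_mem_discZeros {D : ℕ} [NeZero D] (χ : DirichletCharacter ℂ D)
    (x : Chr D) {t : ℝ} (ht : |t - 2 * Real.pi * t0 D| ≤ ell1 D + 1 / 4) {ρ : ℂ}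
    (hρ : ρ ∈ discZeros x.ψ t) : ρ ∈ prodZeroSetOmega χ x := by
  obtain ⟨h0, him, hre1, hre2, -, -⟩ := discZeros_prop x.ψ_ne_one hρ
  refine ⟨⟨?_, ?_⟩, by rw [h0, zero_mul]⟩
  · have e : (ρ - s0 D).re = ρ.re - 1 / 2 := by simp [s0, SmoothWeight.s0_def]
    rw [e, abs_lt]
    constructor <;> linarith
  · have e : (ρ - s0 D).im = ρ.im - 2 * Real.pi * t0 D := by simp [s0, SmoothWeight.s0_def]
    rw [e]
    have h1 : |ρ.im - 2 * Real.pi * t0 D| ≤ |ρ.im - t| + |t - 2 * Real.pi * t0 D| := by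
      have := abs_sub_le ρ.im t (2 * Real.pi * t0 D)
      exact this
    have h81 : (81 : ℝ) / 50 + (ell1 D + 1 / 4) < ell1 D + 2 := by linarith
    linarith

/-- Points `σ + i(t+y)` with `|σ − 1/2| ≤ 1/100`, `0 ≤ y ≤ 1/100` lie in the disc
`|s′ − (2+it)| ≤ 81/50` (the segment of Lemma 5.9's proof inside the Jensen disc).
[cite: Zhang2022LandauSiegel, §5 Lemma 5.9 (proof)] -/
theorem mem_disc {σ t y : ℝ} (hσ : |σ - 1 / 2| ≤ 1 / 100) (hy0 : 0 ≤ y) (hy1 : y ≤ 1 / 100) :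
    (σ : ℂ) + t * I + y * I ∈ closedBall (2 + (t : ℂ) * I) (81 / 50) := by
  rw [Metric.mem_closedBall, dist_eq_norm]
  have e : (σ : ℂ) + t * I + y * I - (2 + t * I) = ((σ - 2 : ℝ) : ℂ) + (y : ℂ) * I := by
    push_cast; ring
  rw [e, Complex.norm_add_mul_I, Real.sqrt_le_left]
  · nlinarith [abs_le.1 hσ]
  · norm_num

/-! ### Bookkeeping of the zero-sum terms at the manuscript's scales -/

/-- For `0 < α ≤ 1/100`, `0 < κ ≤ 1/2`, `r = κα`, `0 < v ≤ α`, `v ≤ g`, `α/2 ≤ g`: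
`((r+v/2)/g+1)·½log((α²+(r+v)²)/r²) + v/r + (v/g)log((81/50)/r) + (v²/2)(1/r²+1/(gr))`
`≤ (3/2)log(4/κ²) + 2/κ + log(2/κ) + 1/κ² + log(1/α)` — the sizes of the three displays of
Lemma 5.9's proof at the manuscript's scales. [cite: Zhang2022LandauSiegel, §5 Lemma 5.9 (proof)] -/
theorem bookkeeping_le {α κ g v : ℝ} (hα0 : 0 < α) (hα : α ≤ 1 / 100) (hκ0 : 0 < κ)
    (hκ : κ ≤ 1 / 2) (hg : α / 2 ≤ g) (hv0 : 0 < v) (hvg : v ≤ g) (hvα : v ≤ α) :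
    ((κ * α + v / 2) / g + 1) * (1 / 2 * Real.log ((α ^ 2 + (κ * α + v) ^ 2) / (κ * α) ^ 2))
      + (v / (κ * α) + v / g * Real.log ((81 / 50) / (κ * α)))
      + v ^ 2 / 2 * (1 / (κ * α) ^ 2 + 1 / (g * (κ * α)))
      ≤ 3 / 2 * Real.log (4 / κ ^ 2) + 2 / κ + Real.log (2 / κ) + 1 / κ ^ 2 + Real.log (1 / α) := by
  have hg0 : 0 < g := lt_of_lt_of_le (by positivity) hg
  have hr0 : 0 < κ * α := by positivity
  -- term 1
  have hcount : (κ * α + v / 2) / g + 1 ≤ 3 := by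
    rw [div_add_one hg0.ne', div_le_iff₀ hg0]; nlinarith
  have hcount0 : 0 ≤ (κ * α + v / 2) / g + 1 := by positivity
  have hX1 : 1 ≤ (α ^ 2 + (κ * α + v) ^ 2) / (κ * α) ^ 2 := by
    rw [le_div_iff₀ (by positivity)]; nlinarith
  have hX4 : (α ^ 2 + (κ * α + v) ^ 2) / (κ * α) ^ 2 ≤ 4 / κ ^ 2 := by
    rw [div_le_div_iff₀ (by positivity) (by positivity)]
    have h1 : κ * α + v ≤ (3 / 2) * α := by nlinarith
    have h2 : (κ * α + v) ^ 2 ≤ ((3 / 2) * α) ^ 2 := by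
      exact pow_le_pow_left₀ (by positivity) h1 2
    nlinarith
  have hlog1 : 1 / 2 * Real.log ((α ^ 2 + (κ * α + v) ^ 2) / (κ * α) ^ 2)
      ≤ 1 / 2 * Real.log (4 / κ ^ 2) := by
    gcongr
  have hlog1' : 0 ≤ 1 / 2 * Real.log ((α ^ 2 + (κ * α + v) ^ 2) / (κ * α) ^ 2) :=
    mul_nonneg (by norm_num) (Real.log_nonneg hX1)
  have hlog4 : 0 ≤ Real.log (4 / κ ^ 2) := by
    refine Real.log_nonneg ?_
    rw [le_div_iff₀ (by positivity)]; nlinarith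
  have ht1 : ((κ * α + v / 2) / g + 1) * (1 / 2 * Real.log ((α ^ 2 + (κ * α + v) ^ 2) / (κ * α) ^ 2))
      ≤ 3 / 2 * Real.log (4 / κ ^ 2) := by
    calc ((κ * α + v / 2) / g + 1) * (1 / 2 * Real.log ((α ^ 2 + (κ * α + v) ^ 2) / (κ * α) ^ 2))
        ≤ 3 * (1 / 2 * Real.log (4 / κ ^ 2)) :=
          mul_le_mul hcount hlog1 hlog1' (by norm_num)
      _ = 3 / 2 * Real.log (4 / κ ^ 2) := by ring
  -- term 2
  have ht2a : v / (κ * α) ≤ 1 / κ := by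
    rw [div_le_div_iff₀ hr0 hκ0]; nlinarith
  have hvg1 : v / g ≤ 1 := by rw [div_le_one hg0]; exact hvg
  have hlogr : Real.log ((81 / 50) / (κ * α)) ≤ Real.log (2 / κ) + Real.log (1 / α) := by
    rw [← Real.log_mul (by positivity) (by positivity)]
    refine Real.log_le_log (by positivity) ?_
    rw [div_le_iff₀ hr0]
    field_simp
    nlinarith
  have hlogr0 : 0 ≤ Real.log ((81 / 50) / (κ * α)) := by
    refine Real.log_nonneg ?_
    rw [le_div_iff₀ hr0]; nlinarith
  have ht2b : v / g * Real.log ((81 / 50) / (κ * α)) ≤ Real.log (2 / κ) + Real.log (1 / α) := by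
    calc v / g * Real.log ((81 / 50) / (κ * α)) ≤ 1 * Real.log ((81 / 50) / (κ * α)) := by gcongr
      _ ≤ Real.log (2 / κ) + Real.log (1 / α) := by rw [one_mul]; exact hlogr
  -- term 3
  have ht3 : v ^ 2 / 2 * (1 / (κ * α) ^ 2 + 1 / (g * (κ * α))) ≤ 1 / κ ^ 2 + 1 / κ := by
    have e : v ^ 2 / 2 * (1 / (κ * α) ^ 2 + 1 / (g * (κ * α)))
        = 1 / 2 * ((v / α) ^ 2 * (1 / κ ^ 2) + (v / g) * (v / α) * (1 / κ)) := by
      field_simp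
    rw [e]
    have hva : v / α ≤ 1 := by rw [div_le_one hα0]; exact hvα
    have hva0 : 0 ≤ v / α := by positivity
    have hvg0 : 0 ≤ v / g := by positivity
    have hk1 : 0 ≤ 1 / κ := by positivity
    have hk2 : 0 ≤ 1 / κ ^ 2 := by positivity
    have h1 : (v / α) ^ 2 * (1 / κ ^ 2) ≤ 1 * (1 / κ ^ 2) := by
      gcongr; nlinarith
    have h2 : (v / g) * (v / α) * (1 / κ) ≤ 1 * 1 * (1 / κ) := by gcongr
    nlinarith
  have hk : 0 ≤ 1 / κ := by positivity
  have h2κ : (2 : ℝ) / κ = 1 / κ + 1 / κ := by ring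
  linarith

/-! ### The size of `ℒ = log p + log(|t|+4)` at the manuscript's scales -/

/-- For `p` in the window (`p < 2P`), `|t − 2πt₀| ≤ 𝓛₁ + 1/4` and `𝓛 ≥ 32`:
`log p + log(|t|+4) ≤ 3𝓛⁹` (`P = e^{𝓛⁹}`, `t₀ = 𝓛⁵¹⁹`, `𝓛₁ = 𝓛⁴⁰⁵`). [cite: Zhang2022LandauSiegel, §2 (2.6)–(2.8)] -/
theorem ell_disc_le {D : ℕ} (hL : 32 ≤ ell D) (x : Chr D) {t : ℝ}
    (ht : |t - 2 * Real.pi * t0 D| ≤ ell1 D + 1 / 4) :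
    Real.log x.p + Real.log (|t| + 4) ≤ 3 * ell D ^ 9 := by
  set L := ell D with hLdef
  have hL1 : 1 ≤ L := by linarith
  have hP : 1 ≤ bigP D := Real.one_le_exp (by positivity)
  -- `p < P(1 + 𝓛⁻⁶⁸) ≤ 2P`
  have hp : (x.p : ℝ) ≤ 2 * bigP D := by
    have hm := x.mem
    rw [primeWindow, Finset.mem_filter, Finset.mem_Ioo] at hm
    have h1 : (x.p : ℝ) < bigP D * (1 + (L ^ 68)⁻¹) := Nat.lt_ceil.mp hm.1.2
    have h2 : (L ^ 68)⁻¹ ≤ 1 := inv_le_one_of_one_le₀ (one_le_pow₀ hL1)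
    nlinarith
  have hlogp : Real.log x.p ≤ 1 + L ^ 9 := by
    have hp0 : (0 : ℝ) < x.p := by exact_mod_cast x.prime.pos
    calc Real.log x.p ≤ Real.log (2 * bigP D) := Real.log_le_log hp0 hp
      _ = Real.log 2 + L ^ 9 := by
          rw [Real.log_mul (by norm_num) (by positivity), bigP, Real.log_exp]
      _ ≤ 1 + L ^ 9 := by linarith [Real.log_two_lt_d9]
  -- `|t| + 4 ≤ 12𝓛⁵¹⁹`, `log(12𝓛⁵¹⁹) ≤ 11 + 519(𝓛 − 1) ≤ 𝓛⁹`
  have ht0 : t0 D = L ^ 519 := rfl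
  have h1 : ell1 D = L ^ 405 := rfl
  have h405 : L ^ 405 ≤ L ^ 519 := pow_le_pow_right₀ hL1 (by norm_num)
  have hL519 : 1 ≤ L ^ 519 := one_le_pow₀ hL1
  have hL519' : L ≤ L ^ 519 := le_self_pow₀ hL1 (by norm_num)
  have hπL : 2 * Real.pi * t0 D ≤ 8 * L ^ 519 := by
    rw [ht0]; nlinarith [Real.pi_lt_four, hL519]
  have hπL0 : 0 ≤ 2 * Real.pi * t0 D := by rw [ht0]; positivity
  have habs : |t| + 4 ≤ 12 * L ^ 519 := by
    obtain ⟨ht1, ht2⟩ := abs_le.mp ht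
    rw [h1] at ht1 ht2
    have : |t| ≤ 12 * L ^ 519 - 4 := abs_le.mpr ⟨by linarith, by linarith⟩
    linarith
  have hlogt : Real.log (|t| + 4) ≤ L ^ 9 := by
    have h12 : Real.log 12 ≤ 11 := by
      have := Real.log_le_sub_one_of_pos (show (0 : ℝ) < 12 by norm_num); linarith
    have hlogL : Real.log L ≤ L - 1 := Real.log_le_sub_one_of_pos (by linarith)
    have hL8 : (519 : ℝ) ≤ L ^ 8 := by
      calc (519 : ℝ) ≤ 32 ^ 8 := by norm_num
        _ ≤ L ^ 8 := pow_le_pow_left₀ (by norm_num) hL 8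
    calc Real.log (|t| + 4) ≤ Real.log (12 * L ^ 519) :=
          Real.log_le_log (by positivity) habs
      _ = Real.log 12 + 519 * Real.log L := by
          rw [Real.log_mul (by norm_num) (by positivity), Real.log_pow]; norm_num
      _ ≤ 519 * L := by nlinarith
      _ ≤ L ^ 9 := by nlinarith
  have hL9 : 1 ≤ L ^ 9 := one_le_pow₀ hL1
  linarith

/-! ### Three small devices for the main deduction -/

/-- **Proposition 2.2 (ii) ⇒ the Jensen-disc weights are `1`.** If `ρ` is a disc zero of `L(·,ψ)`
and the derivative of `L(s,ψ)L(s,ψχ)` at `ρ` is non-zero, then `m(ρ) = 1`.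
[cite: Zhang2022LandauSiegel, §2 Prop. 2.2 (ii)] -/
theorem discDivisor_eq_one_of_deriv_ne_zero {D : ℕ} [NeZero D] (χ : DirichletCharacter ℂ D)
    (x : Chr D) {t : ℝ} {ρ : ℂ} (hρ : ρ ∈ discZeros x.ψ t)
    (hd : deriv (fun w => x.ψ.LFunction w * (psiChi χ x).LFunction w) ρ ≠ 0) :
    discDivisor x.ψ t ρ = 1 := by
  have hψ1 : x.ψ ≠ 1 := x.ψ_ne_one
  obtain ⟨h0, -, -, hre1, hdiv, -⟩ := discZeros_prop hψ1 hρ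
  have hρ1 : ρ ≠ 1 := fun h => by rw [h, Complex.one_re] at hre1; exact lt_irrefl _ hre1
  have hdL : DifferentiableAt ℂ x.ψ.LFunction ρ :=
    DirichletCharacter.differentiableAt_LFunction _ ρ (Or.inl hρ1)
  have hdM : DifferentiableAt ℂ (psiChi χ x).LFunction ρ :=
    DirichletCharacter.differentiableAt_LFunction _ ρ (Or.inl hρ1)
  have hderiv : deriv x.ψ.LFunction ρ ≠ 0 := by
    intro hz
    apply hd
    rw [deriv_fun_mul hdL hdM, hz, h0, zero_mul, zero_mul, add_zero]
  have han : AnalyticAt ℂ x.ψ.LFunction ρ :=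
    (DirichletCharacter.differentiable_LFunction hψ1).analyticAt ρ
  have hord : analyticOrderAt x.ψ.LFunction ρ = 1 :=
    han.analyticOrderAt_eq_one_of_zero_deriv_ne_zero h0 hderiv
  rw [hdiv, zeroOrder, analyticOrderNatAt, hord]
  rfl

/-- **Proposition 2.2 (i)+(iii) ⇒ the disc zeros are `g`-separated in ordinate** for any
`g ≤ α − c′α²𝓛`, once the disc zeros are zeros of `L(s,ψ)L(s,ψχ)` in `Ω` lying on the line.
[cite: Zhang2022LandauSiegel, §2 Prop. 2.2 (iii)] -/
theorem discZeros_separated {D : ℕ} [NeZero D] {χ : DirichletCharacter ℂ D} {x : Chr D}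
    {c' t g : ℝ} (hfin : (prodZeroSetOmega χ x).Finite)
    (hiii : ∀ s ∈ prodZeroSetOmega χ x, ∀ s' ∈ prodZeroSetOmega χ x, s.im < s'.im →
      (∀ s'' ∈ prodZeroSetOmega χ x, ¬ (s.im < s''.im ∧ s''.im < s'.im)) →
        |s'.im - s.im - alpha D| < c' * alpha D ^ 2 * ell D)
    (hZΩ : ∀ ρ ∈ discZeros x.ψ t, ρ ∈ prodZeroSetOmega χ x)
    (hline : ∀ ρ ∈ discZeros x.ψ t, ρ.re = 1 / 2) (hg : g ≤ alpha D - c' * alpha D ^ 2 * ell D) :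
    ∀ ρ ∈ discZeros x.ψ t, ∀ ρ' ∈ discZeros x.ψ t, ρ ≠ ρ' → g ≤ |ρ.im - ρ'.im| := by
  intro ρ hρ ρ' hρ' hne
  have hne_im : ρ.im ≠ ρ'.im := by
    intro h
    exact hne (Complex.ext (by rw [hline ρ hρ, hline ρ' hρ']) h)
  rcases lt_or_gt_of_ne hne_im with hlt | hlt
  · have h := gap_of_consecutive hfin hiii (hZΩ ρ hρ) (hZΩ ρ' hρ') hlt
    rw [abs_sub_comm, abs_of_pos (by linarith)]
    linarith
  · have h := gap_of_consecutive hfin hiii (hZΩ ρ' hρ') (hZΩ ρ hρ) hlt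
    rw [abs_of_pos (by linarith)]
    linarith

end Lemma59Ded

end Literature.NumberTheory.LFunctions.Zhang2022
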